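import Summits.MatrixMultiplication.MatrixMultiplication.Theorems.SoloInformedSchonhageAsymptotic
import Summits.MatrixMultiplication.MatrixMultiplication.Statement
import Mathlib.Order.Interval.Finset.Fin
import HarnessLib

/-!
# The triangular doors `T(U_k) = ⟨k,k,k⟩_{U_k,U_k}`

Solo-informed seat (gen 30), paper §2q, part 2 of 3 (after `SoloInformedSchonhageAsymptotic.lean`:
`f^{ω/3} ≤ R̃(⟨e,h,l⟩_{I,J})`, proved).  Everything here is PROVED.

* **The triangular family.** `upperPattern k = U_k = {(i,j) : i ≤ j}`, `triangularTensor K k =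
  T(U_k) := ⟨k,k,k⟩_{U_k,U_k}` = the structure tensor of the algebra of upper triangular `k × k`
  matrices (the incidence algebra of the `k`-chain), in the padded format `(k²)³`.
  `six_mul_filling_upperPattern`: `6 f(U_k) = k(k+1)(k+2)` (`f(U_k) = binom(k+2,3)` counts the
  chains `i ≤ j ≤ l`; `f(U_2..5) = 4, 10, 20, 35`); `two_mul_card_upperPattern`: `2|U_k| = k(k+1)`;
  the flattening lower bound `card_upperPattern_le_asymptoticRank_triangular`: `|U_k| ≤ R̃(T(U_k))`
  over every field; the sandwich `f(U_k)^{ω/3} ≤ R̃(T(U_k)) ≤ k^ω` over every infinite field.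
* **The triangular doors** `omega_le_of_asymptoticRank_triangular_le`:
  `R̃(T(U_k)) ≤ ρ ⇒ ω ≤ 3 log_{f(U_k)} ρ`.  At the flattening value `ρ = |U_k|` ("`T(U_k)` has
  minimal asymptotic rank", the analogue of the Coppersmith–Winograd doors) this reads
  `ω ≤ 3 log binom(k+1,2) / log binom(k+2,3) = 2.3774 (k=2), 2.3345 (k=3), 2.3058 (k=4),
  2.2851 (k=5), … → 2`: from `k = 3` on — a tensor with `10` nonzero entries, concisely `6 × 6 × 6` —
  the door BEATS THE RECORD `2.3713`: `omega_lt_of_asymptoticRank_triangular_three_le_six`,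
  **`R̃(T(U_3)) ≤ 6 ⇒ ω < 2.335`**.
* **The family decides the summit up to constants**
  `omega_eq_two_iff_asymptoticRank_triangular_le_sq` / `matrixMultiplication_iff_triangular`:
  **`ω(ℂ) = 2 ⟺ ∀ k ≥ 1, R̃(T(U_k)) ≤ k²`** (`⇒`: sandwich; `⇐`: along `k = 2^N`,
  `(k³/6)^{ω/3} ≤ f(U_k)^{ω/3} ≤ k²` forces `2^ω ≤ 4`).  Honest grade: a reformulation
  (`⟨⌈k/3⌉,⌈k/3⌉,⌈k/3⌉⟩ ≤ T(U_k) ≤ ⟨k,k,k⟩`), whose merit is that its members are UNITAL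
  ASSOCIATIVE ALGEBRAS with a Borel-type (solvable) stabiliser — so Borel-fixed border apolarity
  applies (gen 29) — the smallest of which are `3`- and `6`-dimensional; `k = 2` is the door tensor
  `T₂` of gens 24–29 (`SoloInformedTTwoDoor.lean`).  No single `k` is a door to `ω = 2`: at the
  flattening value the door gives `3 log |U_k| / log f(U_k) > 2` (Loomis–Whitney is strict on a
  triangle), and (paper level, §2q) `T(U_k)` is binding, `111`-sharp and not a unit tensor, hence
  irreversible by Theorem R of gen 20 (`ReversibleUnit.irreversible_of_not_unit`) and excluded by the
  Christandl–Vrana–Zuiddam barrier; only `k → ∞` reaches `2`.  Record-relevance: door_k beats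
  `2.3713` iff `R̃(T(U_k)) < f(U_k)^{0.7904}` = `2.99 (k=2: impossible, < 3)`, `6.17 (k=3)`,
  `10.7 (k=4)`, `16.6 (k=5)`; known for `k = 3`: `R(T(U_3)) = 10` (BCS Ex. 17.24),
  `R̲(T(U_3)) ≥ 8` (BCS Cor. (19.14): `R̲(T_m) ≥ m(3m+1)/4`), so `6 ≤ R̃(T(U_3)) ≤ R̲(T(U_3)) ∈ [8, 10]`.

## References

* [BurgisserClausenShokrollahi1997] P. Bürgisser, M. Clausen, M. A. Shokrollahi, *Algebraic
  Complexity Theory*, Springer 1997, §15.9: (15.46), Lemma (15.47), Thm. (15.48), Ex. (15.50)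
  (held, read: PDF pp. 440–444); Ex. 17.23(4) (`T₂`); Ex. 17.24 (`R(T_3) = 10`, `T_n` of minimal
  rank iff `n = 2`; PDF p. 516); Cor. (19.14) (`R̲(T_m) ≥ m(3m+1)/4`; PDF p. 547).
* [Schonhage1981] A. Schönhage, *Partial and total matrix multiplication*, SIAM J. Comput. 10
  (1981) 434–455, Thm. 4.1.
* [AlmanDuanVassilevskaWilliamsXuXuZhou2025] J. Alman et al., SODA 2025 = arXiv:2404.16349, §3.4
  (`R̃(⟨q,q,q⟩) = q^ω`); the record `ω < 2.371339`.
* [ChristandlVranaZuiddam2023] M. Christandl, P. Vrana, J. Zuiddam, *Universal points in the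
  asymptotic spectrum of tensors*, J. AMS 36 (2023), §1.1 (`R̃`), Example 1.4 (flattening ranks).
* [Blaser2013] M. Bläser, *Fast Matrix Multiplication*, ToC Graduate Surveys 5 (2013), Lemma 5.4,
  Lemma 7.1.
* [Alman2021] J. Alman, Theory of Computing 17 (2021), §2.4 (`R̃` is monotone under degeneration).
-/

noncomputable section

open scoped BigOperators

namespace Summit.MatrixMultiplication.MatrixMultiplication.Theorems

open Literature.Computability.AlgebraicComplexity
open Literature.Barriers.MatrixMultiplication (asymptoticRank_le_of_polyDegeneratesTo
  flatteningRank_le_asymptoticRank)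

/-! ## The triangular patterns `U_k` and the tensors `T(U_k) = ⟨k,k,k⟩_{U_k,U_k}` -/

section Triangular

/-- The upper triangular pattern `U_k = {(i,j) : i ≤ j} ⊆ [k] × [k]` (the support of the algebra
of upper triangular `k × k` matrices = the incidence algebra of the `k`-chain).
[cite: BurgisserClausenShokrollahi1997, §15.9] -/
def upperPattern (k : ℕ) : Finset (Fin k × Fin k) := Finset.univ.filter fun p => p.1 ≤ p.2

/-- Membership in `U_k`. [folklore] -/
@[simp] theorem mem_upperPattern {k : ℕ} (p : Fin k × Fin k) : p ∈ upperPattern k ↔ p.1 ≤ p.2 := by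
  simp [upperPattern]

variable (K : Type*) [Field K]

/-- **`T(U_k) := ⟨k,k,k⟩_{U_k,U_k}`**, the partial matrix multiplication "upper triangular times
upper triangular" = the structure tensor of the algebra `U_k` of upper triangular `k × k` matrices
(in the format `(k²)³`, padded by zero slices). [cite: BurgisserClausenShokrollahi1997, §15.9] -/
def triangularTensor (k : ℕ) : Fin k × Fin k → Fin k × Fin k → Fin k × Fin k → K :=
  partialMatMulTensor K k k k (upperPattern k) (upperPattern k)

/-- `2 · ∑_{j<k} (j+1) = k (k+1)`. [folklore] -/
private theorem two_mul_sum_succ (k : ℕ) : 2 * ∑ j ∈ Finset.range k, (j + 1) = k * (k + 1) := by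
  induction k with
  | zero => simp
  | succ k ih => rw [Finset.sum_range_succ, mul_add, ih]; ring

/-- `6 · ∑_{j<k} (j+1)(k-j) = k (k+1) (k+2)`. [folklore] -/
private theorem six_mul_sum_succ_mul_sub (k : ℕ) :
    6 * ∑ j ∈ Finset.range k, (j + 1) * (k - j) = k * (k + 1) * (k + 2) := by
  induction k with
  | zero => simp
  | succ k ih =>
      have hsplit : ∑ j ∈ Finset.range (k + 1), (j + 1) * (k + 1 - j) =
          ∑ j ∈ Finset.range k, (j + 1) * (k - j) + ∑ j ∈ Finset.range k, (j + 1) + (k + 1) := by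
        rw [Finset.sum_range_succ, ← Finset.sum_add_distrib, Nat.add_sub_cancel_left]
        congr 1
        · refine Finset.sum_congr rfl fun j hj => ?_
          rw [Finset.mem_range] at hj
          rw [show k + 1 - j = (k - j) + 1 by omega]
          ring
        · ring
      rw [hsplit, mul_add, mul_add, ih]
      have h2 := two_mul_sum_succ k
      nlinarith [h2]

/-- **The filling of `(U_k, U_k)` is `binom(k+2, 3)`**: `6 f = k(k+1)(k+2)` (the filled products are
the chains `i ≤ j ≤ l`; `f = ∑_j m_j p_j` with `m_j = j+1`, `p_j = k-j`).
[cite: BurgisserClausenShokrollahi1997, Thm. (15.48)] -/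
theorem six_mul_filling_upperPattern (k : ℕ) :
    6 * filling k k k (upperPattern k) (upperPattern k) = k * (k + 1) * (k + 2) := by
  rw [filling_eq_sum_card_mul_card]
  have hm : ∀ j : Fin k, (Finset.univ.filter fun i : Fin k => (i, j) ∈ upperPattern k).card =
      (j : ℕ) + 1 := by
    intro j
    have : (Finset.univ.filter fun i : Fin k => (i, j) ∈ upperPattern k) = Finset.Iic j := by
      ext i; simp
    rw [this, Fin.card_Iic]
  have hp : ∀ j : Fin k, (Finset.univ.filter fun l : Fin k => (j, l) ∈ upperPattern k).card =
      k - (j : ℕ) := by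
    intro j
    have : (Finset.univ.filter fun l : Fin k => (j, l) ∈ upperPattern k) = Finset.Ici j := by
      ext l; simp
    rw [this, Fin.card_Ici]
  simp_rw [hm, hp]
  rw [Fin.sum_univ_eq_sum_range (fun j => (j + 1) * (k - j)) k]
  exact six_mul_sum_succ_mul_sub k

/-- **`|U_k| = binom(k+1, 2)`**: `2 |U_k| = k (k+1)`. [folklore] -/
theorem two_mul_card_upperPattern (k : ℕ) : 2 * (upperPattern k).card = k * (k + 1) := by
  have h1 : (upperPattern k).card = ∑ j : Fin k, ((j : ℕ) + 1) := by
    unfold upperPattern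
    rw [Finset.card_filter]
    rw [Fintype.sum_prod_type_right]
    refine Finset.sum_congr rfl fun j _ => ?_
    rw [← Finset.card_filter]
    have : (Finset.univ.filter fun i : Fin k => i ≤ j) = Finset.Iic j := by ext i; simp
    rw [this, Fin.card_Iic]
  rw [h1, Fin.sum_univ_eq_sum_range (fun j => j + 1) k]
  exact two_mul_sum_succ k

/-- The small fillings: `f(U_2) = 4` (then `10, 20, 35, …`). [cite: BurgisserClausenShokrollahi1997, Thm. (15.48)] -/
theorem filling_upperPattern_two : filling 2 2 2 (upperPattern 2) (upperPattern 2) = 4 := by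
  have := six_mul_filling_upperPattern 2; omega

/-- `f(U_3) = 10`. [cite: BurgisserClausenShokrollahi1997, Thm. (15.48)] -/
theorem filling_upperPattern_three : filling 3 3 3 (upperPattern 3) (upperPattern 3) = 10 := by
  have := six_mul_filling_upperPattern 3; omega

/-- `f(U_4) = 20`. [cite: BurgisserClausenShokrollahi1997, Thm. (15.48)] -/
theorem filling_upperPattern_four : filling 4 4 4 (upperPattern 4) (upperPattern 4) = 20 := by
  have := six_mul_filling_upperPattern 4; omega

/-- `f(U_5) = 35`. [cite: BurgisserClausenShokrollahi1997, Thm. (15.48)] -/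
theorem filling_upperPattern_five : filling 5 5 5 (upperPattern 5) (upperPattern 5) = 35 := by
  have := six_mul_filling_upperPattern 5; omega

/-- **Flattening lower bound `|U_k| ≤ R̃(T(U_k))`** over every field: the output slice at
`(i,l) ∈ U_k` is the only one with a nonzero entry at `(x_{ii}, y_{il})`.
[cite: Blaser2013, Lemma 7.1 (2)] -/
theorem card_upperPattern_le_asymptoticRank_triangular (K : Type) [Field K] (k : ℕ) :
    ((upperPattern k).card : ℝ) ≤ asymptoticRank (triangularTensor K k) := by
  classical
  refine card_le_asymptoticRank_of_dualPairsOn (triangularTensor K k) (upperPattern k)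
    (fun o => (o.1, o.1)) (fun o => (o.1, o.2)) fun o ho o' => ?_
  rw [mem_upperPattern] at ho
  unfold triangularTensor
  rw [partialMatMulTensor_apply]
  refine ite_congr_prop ?_
  simp only [mem_upperPattern, le_refl, ho, and_self, true_and, Prod.ext_iff]

variable (K : Type) [Field K] [Infinite K]

/-- **Schönhage for `T(U_k)`: `f(U_k)^{ω/3} ≤ R̃(T(U_k))`**, `6 f(U_k) = k(k+1)(k+2)`.
[cite: BurgisserClausenShokrollahi1997, Thm. (15.48)] -/
theorem filling_rpow_le_asymptoticRank_triangular (k : ℕ) :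
    (filling k k k (upperPattern k) (upperPattern k) : ℝ) ^ (omega K / 3) ≤
      asymptoticRank (triangularTensor K k) :=
  filling_rpow_le_asymptoticRank K k k k _ _

omit [Infinite K] in
/-- **The sandwich `f(U_k)^{ω/3} ≤ R̃(T(U_k)) ≤ k^ω`** (`k ≥ 1`).
[cite: BurgisserClausenShokrollahi1997, Thm. (15.48)] -/
theorem asymptoticRank_triangular_le_rpow_omega {k : ℕ} (hk : 1 ≤ k) :
    asymptoticRank (triangularTensor K k) ≤ (k : ℝ) ^ omega K :=
  asymptoticRank_partialMatMulTensor_le_rpow_omega K hk _ _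

/-- **The triangular door `door_k`: `R̃(T(U_k)) ≤ ρ ⇒ ω ≤ 3 log_{f(U_k)} ρ`** (`k ≥ 2`); at the
flattening value `ρ = |U_k| = binom(k+1,2)` this is `ω ≤ 3 log binom(k+1,2) / log binom(k+2,3)`
`= 2.3774 (k=2), 2.3345 (k=3), 2.3058 (k=4), 2.2851 (k=5), … → 2`.
[cite: BurgisserClausenShokrollahi1997, Thm. (15.48)] -/
theorem omega_le_of_asymptoticRank_triangular_le {k : ℕ} (hk : 2 ≤ k) {ρ : ℝ}
    (hρ : asymptoticRank (triangularTensor K k) ≤ ρ) :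
    omega K ≤ 3 * Real.logb (filling k k k (upperPattern k) (upperPattern k)) ρ := by
  refine omega_le_three_mul_logb_of_asymptoticRank_le K ?_ hρ
  have h6 := six_mul_filling_upperPattern k
  have : 2 * 3 * 4 ≤ k * (k + 1) * (k + 2) :=
    Nat.mul_le_mul (Nat.mul_le_mul hk (by omega)) (by omega)
  omega

set_option exponentiation.threshold 700 in
/-- **`door_3` beats the record:** `R̃(T(U_3)) ≤ 6` (the flattening value, `|U_3| = 6`) implies
`10^{ω/3} ≤ 6`, so `ω < 2.335 < 2.3713`. [cite: BurgisserClausenShokrollahi1997, Thm. (15.48)] -/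
theorem omega_lt_of_asymptoticRank_triangular_three_le_six
    (h : asymptoticRank (triangularTensor K 3) ≤ 6) : omega K < 2.335 := by
  have key := (filling_rpow_le_asymptoticRank_triangular K 3).trans h
  rw [filling_upperPattern_three] at key
  push_cast at key
  by_contra hω
  rw [not_lt] at hω
  -- `10^{467/600} ≤ 10^{ω/3} ≤ 6`, but `6^600 < 10^467`
  have h1 : (10 : ℝ) ^ ((467 : ℝ) / 600) ≤ (10 : ℝ) ^ (omega K / 3) :=
    Real.rpow_le_rpow_of_exponent_le (by norm_num) (by linarith)
  have h2 : ((10 : ℝ) ^ ((467 : ℝ) / 600)) ^ (600 : ℕ) = (10 : ℝ) ^ (467 : ℕ) := by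
    rw [← Real.rpow_natCast, ← Real.rpow_mul (by norm_num)]
    norm_num
  have h3 : ((10 : ℝ) ^ ((467 : ℝ) / 600)) ^ (600 : ℕ) ≤ (6 : ℝ) ^ (600 : ℕ) :=
    pow_le_pow_left₀ (by positivity) (h1.trans key) 600
  rw [h2] at h3
  norm_num at h3

/-- **The triangular family decides the summit up to constants:**
`ω = 2 ⟺ R̃(T(U_k)) ≤ k²` for all `k ≥ 1` (`⇒`: `R̃(T(U_k)) ≤ R̃(⟨k,k,k⟩) = k^ω`;
`⇐`: `(k³/6)^{ω/3} ≤ f(U_k)^{ω/3} ≤ k²` along `k = 2^N` forces `2^ω ≤ 4`).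
[cite: BurgisserClausenShokrollahi1997, Thm. (15.48)] -/
theorem omega_eq_two_iff_asymptoticRank_triangular_le_sq :
    omega K = 2 ↔ ∀ k : ℕ, 1 ≤ k → asymptoticRank (triangularTensor K k) ≤ (k : ℝ) ^ 2 := by
  constructor
  · intro hω k hk
    have h := asymptoticRank_triangular_le_rpow_omega K hk
    rw [hω, Real.rpow_two] at h
    exact h
  · intro h
    refine le_antisymm ?_ (omega_two_le K)
    have hω0 : 0 ≤ omega K := by linarith [omega_two_le K]
    have hω3 : omega K / 3 ≤ 1 := by linarith [omega_le_three' K]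
    -- `2^ω ≤ 4`
    suffices hmain : (2 : ℝ) ^ omega K ≤ (2 : ℝ) ^ (2 : ℝ) by
      exact (Real.rpow_le_rpow_left_iff one_lt_two).1 hmain
    rw [Real.rpow_two]
    refine le_of_forall_pow_le_polynomial_mul_pow _ _ 6 0 (by norm_num) fun N => ?_
    set k : ℕ := 2 ^ N with hk
    have hk1 : 1 ≤ k := Nat.one_le_two_pow
    have hk0 : (0 : ℝ) ≤ k := Nat.cast_nonneg _
    have hf := (filling_rpow_le_asymptoticRank_triangular K k).trans (h k hk1)
    have h6 : (k : ℝ) ^ (3 : ℕ) ≤ 6 * (filling k k k (upperPattern k) (upperPattern k) : ℝ) := by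
      have := six_mul_filling_upperPattern k
      have hle : k ^ 3 ≤ 6 * filling k k k (upperPattern k) (upperPattern k) := by
        rw [this]; nlinarith
      exact_mod_cast hle
    calc ((2 : ℝ) ^ omega K) ^ N = (k : ℝ) ^ omega K := by
          rw [← Real.rpow_natCast, ← Real.rpow_mul (by norm_num), mul_comm,
            Real.rpow_mul (by norm_num), Real.rpow_natCast, hk]
          push_cast; rfl
      _ = ((k : ℝ) ^ (3 : ℕ)) ^ (omega K / 3) := by
          rw [← Real.rpow_natCast, ← Real.rpow_mul hk0]
          congr 1; push_cast; ring
      _ ≤ (6 * (filling k k k (upperPattern k) (upperPattern k) : ℝ)) ^ (omega K / 3) :=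
          Real.rpow_le_rpow (by positivity) h6 (by positivity)
      _ = (6 : ℝ) ^ (omega K / 3) *
            (filling k k k (upperPattern k) (upperPattern k) : ℝ) ^ (omega K / 3) :=
          Real.mul_rpow (by norm_num) (Nat.cast_nonneg _)
      _ ≤ 6 * (k : ℝ) ^ 2 := by
          refine mul_le_mul ?_ hf (by positivity) (by norm_num)
          calc (6 : ℝ) ^ (omega K / 3) ≤ (6 : ℝ) ^ (1 : ℝ) :=
                Real.rpow_le_rpow_of_exponent_le (by norm_num) hω3
            _ = 6 := Real.rpow_one _
      _ = 6 * ((N : ℝ) + 1) ^ 0 * ((2 : ℝ) ^ 2) ^ N := by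
          rw [pow_right_comm, hk]; push_cast; ring

end Triangular

/-! ## The summit in the triangular language -/

section Summit

/-- **The summit in the triangular language**: `ω(ℂ) = 2 ⟺ ∀ k ≥ 1, R̃(T(U_k)) ≤ k²`.
[cite: BurgisserClausenShokrollahi1997, Thm. (15.48)] -/
theorem matrixMultiplication_iff_triangular :
    _root_.MatrixMultiplication ↔
      ∀ k : ℕ, 1 ≤ k → asymptoticRank (triangularTensor ℂ k) ≤ (k : ℝ) ^ 2 :=
  _root_.MatrixMultiplication_iff.trans (omega_eq_two_iff_asymptoticRank_triangular_le_sq ℂ)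

end Summit


end Summit.MatrixMultiplication.MatrixMultiplication.Theorems

end
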